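import Summits.QuantumFields.YangMills.Theorems.BalabanUVNodesN19SingleModeFirstOrder

/-!
# YM-DAG node N19 (= NE7 proper) — THE SMOOTHED-LINK FIRST-ORDER LAW
# (`g(S) = g(A_J) + g′(A_J)(A_N − A_J) + O(B₂(dπ∕2^J)² + B₁dπ∕N)` for a trigonometric link `g`, with `g(A_J)`, `g′(A_J)` through the character ladders)

Cell `pub-ymgap`, HUMAN RULING D-0062 (Track A) ∕ D-0149 (work-bound push), R141 (C) wider-strategy seat `pub-ymgap-dag-n19-e` (strategy
s3 = ALTERNATIVE CURRENCY), generation g33, module 1 (lineage module 151).  Route `Summits/QuantumFields/YangMills/Theses/BalabanUVNodes.lean`,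
cluster item K3⁸ «SpineGivenEndpointR13SepCoPHV» (stmt-QuantumFields-27366); filed `--supports` that item `--as helper` (it proves no registered
stub).  COUNT-NEUTRAL: [folklore]∕[bookkeeping] approximation theory over Mathlib (`MvPolynomial.totalDegree`, `Complex.exp`) and, BY NAME, the
lineage's modules 118 `…N19SingleModeMultiscale` (`exists_pair_near_cexp_sum`, the ladder engine), 119 `…N19SingleModeL1Norm`
(`exists_additiveJackson`, `abs_l1Norm_sub_half_le`) and 139 `…N19SingleModeFirstOrder` (the first-order device, re-run here for a general link);
no laws, no scheme object, no Theses import; NOT a discharge claim.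

CONTEXT — THE RESEARCH ITEM (v′) OF CURRENCY-MAP v11 ∕ OPEN-PROBLEM.md: `d∕(π(9t+6)) ≤ sup_{h 1-Lip} dist_∞(h∘S_d, Π_t) ≲ d∕√t` (module 134 ∕
module 111), conjectured `Θ(d∕t)`; the dead end «Fourier synthesis loses `√`» prices a link by the ℓ¹ MASS of its modes.
THE DEVICE — PRICE THE TWO POLYNOMIAL ERRORS BY THE LINK'S `C^{1,1}` DATA.  For a trigonometric link `g = c + Σ_p(α_p cos ω_p· + β_p sin ω_p·)` with
`|g(u) − g(a) − g′(a)(u − a)| ≤ B₂(u − a)²`, `|g′| ≤ B₁`: `g(S) = g(A_J) + g′(A_J)(S − A_J) + O(B₂(dπ∕2^J)²)` (`A_J` the additive Jackson approximant)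
and `g′(A_J)(S − A_J) = g′(A_J)(A_N − A_J) + O(B₁dπ∕N)` — module 139's first-order step with `g` in place of the character; `g(A_J)`, `g′(A_J)` FACTOR
THROUGH THE CHARACTERS `e^{iω_pA_J}`, which ONE ladder (§1: the same `A_J` for every frequency) realises within `2(J+1)e^{−h}` each, so the mass
`W = Σ_p(|α_p| + |β_p|)` multiplies only the EXPONENTIALLY small ladder error.  §1 `exists_ladder_pairs_near_cexp_additiveJackson_uniform` · §2 real
faces of a pair · §3 ★★★ `exists_mvPolynomial_near_trigLink_firstOrder` (PARAMETRIC: degree `≤ 2e²Ωd(½ + π + 3πJ) + 2h(2^{J+1} − 1) + 2N`, error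
`≤ B₂(dπ∕2^J)² + B₁dπ∕N + 2(J+1)e^{−h}W(1 + Ω(dπ∕2^J + dπ∕N))`).  The sequel smooths a Lipschitz `h` (Fejér–Steklov: `B₁ ≍ Lip h`, `B₂ ≍ Lip h·L∕d`,
`Ω = Lπ∕d`, `|g − h| ≲ Lip h·d log L∕L`) and takes `4^J ≍ Lt`, `N ≍ t`, `h ≍ 3log t`, `L ≍ t∕log₂²t`: `dist_∞(h∘S_d, Π_t) ≲ Lip h·d·log³t∕t` — (v′) up to `log³`.

HONEST FRAMING (binding).  Elementary and [folklore]; ONE-SIDED (upper bounds); NO consumer in the DAG today (an optimality map of the seat's own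
currency, degree model); nothing of Bałaban's instantiated; NE7 NOT PRINTED, NOT proved; N19 NOT discharged; count-neutral.  One finite `T⁴` programme
at fixed `ε`; nothing continuum ∕ `ℝ⁴` ∕ OS ∕ mass-gap ∕ Clay.  0 `def` ∕ 0 `sorry`.
-/

noncomputable section

open Finset Complex
open scoped Real

namespace Summit.QuantumFields.YangMills.Theorems.BalabanUVNodesN19SmoothLinkFirstOrder

open Summit.QuantumFields.YangMills.Theorems.BalabanUVNodesN19SingleModeMultiscale (exists_pair_near_cexp_sum)
open Summit.QuantumFields.YangMills.Theorems.BalabanUVNodesN19SingleModeL1Norm (exists_additiveJackson abs_l1Norm_sub_half_le)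

variable {ι : Type*} [Fintype ι]

/-! ## §1 One ladder for all frequencies [folklore] -/

/-- **ONE LADDER FOR ALL FREQUENCIES.**  For `J : ℕ` and `h ≥ 1` with `(J+1)e^{−h} ≤ ½` there is a real `MvPolynomial` `A` (`= A_J`, the additive
Jackson approximant with `M = 2^J`: `deg A ≤ 2^{J+1}`, `|Σ_i|x_i| − A(x)| ≤ dπ∕2^J` on `[−1,1]^ι`, `d = |ι|`) such that for EVERY `ω ≥ 0` there is a pair
of real `MvPolynomial`s `(Cr, Ci)` of total degree `≤ 2e²·ωd·(½ + π + 3πJ) + 2h·(2^{J+1} − 1)` with `‖Cr(x) + Ci(x)·i − e^{iωA(x)}‖ ≤ 2(J+1)e^{−h}` on the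
cube.  Module 139's `exists_ladder_pair_near_cexp_additiveJackson` with the quantifiers in the useful order (the ladder `A_l`, `l ≤ J`, is chosen
BEFORE `ω`; only the Taylor orders `⌈e²ωR_l⌉ + h` depend on `ω`); proof verbatim otherwise. [folklore] -/
theorem exists_ladder_pairs_near_cexp_additiveJackson_uniform (J h : ℕ) (hh : 1 ≤ h)
    (hJh : ((J : ℝ) + 1) * Real.exp (-(h : ℝ)) ≤ 1 / 2) :
    ∃ A : MvPolynomial ι ℝ, A.totalDegree ≤ 2 * 2 ^ J ∧
      (∀ x : ι → ℝ, (∀ i, x i ∈ Set.Icc (-1 : ℝ) 1) → |(∑ i, |x i|) - MvPolynomial.eval x A| ≤ Fintype.card ι * π / 2 ^ J) ∧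
      ∀ ω : ℝ, 0 ≤ ω → ∃ Cr Ci : MvPolynomial ι ℝ,
        (Cr.totalDegree : ℝ) ≤ 2 * Real.exp 2 * ω * Fintype.card ι * (1 / 2 + π + 3 * π * J) + 2 * h * (2 ^ (J + 1) - 1) ∧
        (Ci.totalDegree : ℝ) ≤ 2 * Real.exp 2 * ω * Fintype.card ι * (1 / 2 + π + 3 * π * J) + 2 * h * (2 ^ (J + 1) - 1) ∧
        ∀ x : ι → ℝ, (∀ i, x i ∈ Set.Icc (-1 : ℝ) 1) →
          ‖((MvPolynomial.eval x Cr : ℝ) : ℂ) + ((MvPolynomial.eval x Ci : ℝ) : ℂ) * I -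
              exp (((ω * MvPolynomial.eval x A : ℝ) : ℂ) * I)‖ ≤ 2 * ((J : ℝ) + 1) * Real.exp (-(h : ℝ)) := by
  set d : ℝ := (Fintype.card ι : ℝ) with hd
  have hd0 : 0 ≤ d := Nat.cast_nonneg _
  -- the Jackson ladder (chosen once, for all frequencies)
  choose A hAdeg hAerr using fun l : ℕ => exists_additiveJackson (ι := ι) (M := 2 ^ l) (pow_pos two_pos l)
  obtain ⟨A', hA'0, hA's⟩ : ∃ A' : ℕ → MvPolynomial ι ℝ, A' 0 = MvPolynomial.C (d / 2) ∧ ∀ l, A' (l + 1) = A l :=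
    ⟨fun l => if l = 0 then MvPolynomial.C (d / 2) else A (l - 1), if_pos rfl, fun l => by
      show (if l + 1 = 0 then MvPolynomial.C (d / 2) else A (l + 1 - 1)) = A l
      rw [if_neg (Nat.succ_ne_zero l), Nat.add_sub_cancel]⟩
  obtain ⟨B, hB⟩ : ∃ B : ℕ → MvPolynomial ι ℝ, ∀ l, B l = A l - A' l := ⟨fun l => A l - A' l, fun l => rfl⟩
  obtain ⟨R, hR0', hRs⟩ : ∃ R : ℕ → ℝ, R 0 = d * (1 / 2 + π) ∧ ∀ l, R (l + 1) = 3 * d * π / 2 ^ (l + 1) :=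
    ⟨fun l => if l = 0 then d * (1 / 2 + π) else 3 * d * π / 2 ^ l, if_pos rfl, fun l => if_neg (Nat.succ_ne_zero l)⟩
  obtain ⟨m, hm⟩ : ∃ m : ℕ → ℕ, ∀ l, m l = 2 * 2 ^ l := ⟨fun l => 2 * 2 ^ l, fun l => rfl⟩
  have hR0 : ∀ l, 0 ≤ R l := fun l => by cases l with | zero => rw [hR0']; positivity | succ l => rw [hRs]; positivity
  have hdegB : ∀ l, l < J + 1 → (B l).totalDegree ≤ m l := by
    intro l _
    rw [hB, hm]
    refine (MvPolynomial.totalDegree_sub _ _).trans (max_le ((hAdeg l).trans le_rfl) ?_)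
    cases l with
    | zero => rw [hA'0, MvPolynomial.totalDegree_C]; exact Nat.zero_le _
    | succ l =>
      rw [hA's]
      exact (hAdeg l).trans (Nat.mul_le_mul_left _ (Nat.pow_le_pow_right two_pos (Nat.le_succ l)))
  have hRB : ∀ l, l < J + 1 → ∀ x : ι → ℝ, (∀ i, x i ∈ Set.Icc (-1 : ℝ) 1) → |MvPolynomial.eval x (B l)| ≤ R l := by
    intro l _ x hx
    rw [hB, map_sub]
    cases l with
    | zero =>
      rw [hA'0, hR0', MvPolynomial.eval_C]
      have h1 := hAerr 0 x hx
      have h2 := abs_l1Norm_sub_half_le x hx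
      rw [pow_zero, Nat.cast_one, div_one] at h1
      calc |MvPolynomial.eval x (A 0) - d / 2|
          ≤ |MvPolynomial.eval x (A 0) - (∑ i, |x i|)| + |(∑ i, |x i|) - d / 2| := abs_sub_le _ _ _
        _ ≤ d * π + d / 2 := by rw [abs_sub_comm] at h1; exact add_le_add h1 h2
        _ = d * (1 / 2 + π) := by ring
    | succ l =>
      rw [hA's, hRs]
      have h1 := hAerr (l + 1) x hx
      have h2 := hAerr l x hx
      calc |MvPolynomial.eval x (A (l + 1)) - MvPolynomial.eval x (A l)|
          ≤ |MvPolynomial.eval x (A (l + 1)) - (∑ i, |x i|)| + |(∑ i, |x i|) - MvPolynomial.eval x (A l)| := abs_sub_le _ _ _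
        _ ≤ d * (π / (2 ^ (l + 1) : ℕ)) + d * (π / (2 ^ l : ℕ)) := by rw [abs_sub_comm] at h1; exact add_le_add h1 h2
        _ = 3 * d * π / 2 ^ (l + 1) := by push_cast; rw [pow_succ]; field_simp; ring
  -- degree bookkeeping of the increments (independent of `ω`)
  have hRm0 : R 0 * (m 0 : ℝ) = 2 * d * (1 / 2 + π) := by rw [hR0', hm]; push_cast; ring
  have hRms : ∀ l, R (l + 1) * (m (l + 1) : ℝ) = 6 * d * π := by
    intro l
    rw [hRs, hm]; push_cast
    have h2 : (2 : ℝ) ^ (l + 1) ≠ 0 := pow_ne_zero _ two_ne_zero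
    field_simp; ring
  have hsumRm : ∑ l ∈ range (J + 1), R l * (m l : ℝ) = 2 * d * (1 / 2 + π) + 6 * d * π * J := by
    rw [Finset.sum_range_succ', hRm0, Finset.sum_congr rfl fun l _ => hRms l, sum_const, card_range, nsmul_eq_mul]
    ring
  have hsumm : ∑ l ∈ range (J + 1), (m l : ℝ) = 2 * (2 ^ (J + 1) - 1) := by
    have hg := geom_sum_eq (x := (2 : ℝ)) (by norm_num) (J + 1)
    rw [Finset.sum_congr rfl fun l _ => show (m l : ℝ) = 2 * 2 ^ l by rw [hm]; push_cast; ring, ← Finset.mul_sum, hg]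
    ring
  -- the telescoping identity (independent of `ω`)
  have hsumB : ∀ x : ι → ℝ, ∑ l ∈ range (J + 1), MvPolynomial.eval x (B l) = MvPolynomial.eval x (A J) - d / 2 := by
    intro x
    have hsub : ∀ l, MvPolynomial.eval x (B l) = MvPolynomial.eval x (A l) - MvPolynomial.eval x (A' l) := fun l => by
      rw [hB, map_sub]
    simp only [hsub, Finset.sum_sub_distrib]
    rw [Finset.sum_range_succ (fun l => MvPolynomial.eval x (A l)), Finset.sum_range_succ' (fun l => MvPolynomial.eval x (A' l))]
    have hxA'0 : MvPolynomial.eval x (A' 0) = d / 2 := by rw [hA'0, MvPolynomial.eval_C]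
    have hxA's : ∀ l, MvPolynomial.eval x (A' (l + 1)) = MvPolynomial.eval x (A l) := fun l => by rw [hA's]
    simp only [hxA'0, hxA's]
    ring
  refine ⟨A J, hAdeg J, fun x hx => (hAerr J x hx).trans_eq (by push_cast; ring), fun ω hω => ?_⟩
  -- the Taylor orders for this `ω`
  obtain ⟨n, hn⟩ : ∃ n : ℕ → ℕ, ∀ l, n l = ⌈Real.exp 2 * (ω * R l)⌉₊ + h := ⟨fun l => ⌈Real.exp 2 * (ω * R l)⌉₊ + h, fun l => rfl⟩
  have hnl : ∀ l, l < J + 1 → 1 ≤ n l ∧ Real.exp 2 * (ω * R l) ≤ n l := by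
    intro l _
    rw [hn]
    refine ⟨hh.trans (Nat.le_add_left h _), ?_⟩
    push_cast
    exact (Nat.le_ceil _).trans (le_add_of_nonneg_right (Nat.cast_nonneg _))
  have hηl : ∀ l, Real.exp (ω * R l - n l) ≤ Real.exp (-(h : ℝ)) := by
    intro l
    refine Real.exp_le_exp.2 ?_
    rw [hn]; push_cast
    have h1 : ω * R l ≤ Real.exp 2 * (ω * R l) := by
      have : (1 : ℝ) ≤ Real.exp 2 := Real.one_le_exp (by norm_num)
      nlinarith [mul_nonneg hω (hR0 l)]
    have h2 := Nat.le_ceil (Real.exp 2 * (ω * R l))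
    linarith
  have hηsum : ∑ l ∈ range (J + 1), Real.exp (ω * R l - n l) ≤ ((J : ℝ) + 1) * Real.exp (-(h : ℝ)) := by
    calc ∑ l ∈ range (J + 1), Real.exp (ω * R l - n l) ≤ ∑ _l ∈ range (J + 1), Real.exp (-(h : ℝ)) :=
          Finset.sum_le_sum fun l _ => hηl l
      _ = ((J : ℝ) + 1) * Real.exp (-(h : ℝ)) := by rw [sum_const, card_range, nsmul_eq_mul]; push_cast; ring
  -- the ladder
  obtain ⟨Cr, Ci, hCr, hCi, happ⟩ := exists_pair_near_cexp_sum (ι := ι) (ω * (d / 2)) hω B m n R (J + 1) hdegB hRB hnl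
    (hηsum.trans hJh)
  have hdeg : ((∑ l ∈ range (J + 1), (n l - 1) * m l : ℕ) : ℝ) ≤
      2 * Real.exp 2 * ω * d * (1 / 2 + π + 3 * π * J) + 2 * h * (2 ^ (J + 1) - 1) := by
    push_cast
    have hterm : ∀ l ∈ range (J + 1), (((n l - 1 : ℕ) : ℝ)) * (m l : ℝ) ≤ (Real.exp 2 * ω) * (R l * m l) + h * (m l : ℝ) := by
      intro l hl
      have hn1 : 1 ≤ n l := (hnl l (mem_range.1 hl)).1
      have hcast : ((n l - 1 : ℕ) : ℝ) = (⌈Real.exp 2 * (ω * R l)⌉₊ : ℝ) + h - 1 := by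
        rw [Nat.cast_sub hn1, hn]; push_cast; ring
      have hceil : (⌈Real.exp 2 * (ω * R l)⌉₊ : ℝ) < Real.exp 2 * (ω * R l) + 1 :=
        Nat.ceil_lt_add_one (mul_nonneg (Real.exp_pos _).le (mul_nonneg hω (hR0 l)))
      have hm0 : (0 : ℝ) ≤ m l := Nat.cast_nonneg _
      rw [hcast]
      nlinarith
    calc ∑ l ∈ range (J + 1), ((n l - 1 : ℕ) : ℝ) * (m l : ℝ)
        ≤ ∑ l ∈ range (J + 1), ((Real.exp 2 * ω) * (R l * m l) + h * (m l : ℝ)) := Finset.sum_le_sum hterm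
      _ = (Real.exp 2 * ω) * ∑ l ∈ range (J + 1), R l * (m l : ℝ) + h * ∑ l ∈ range (J + 1), (m l : ℝ) := by
          rw [Finset.sum_add_distrib, Finset.mul_sum, Finset.mul_sum]
      _ = 2 * Real.exp 2 * ω * d * (1 / 2 + π + 3 * π * J) + 2 * h * (2 ^ (J + 1) - 1) := by
          rw [hsumRm, hsumm]; ring
  refine ⟨Cr, Ci, (Nat.cast_le.2 hCr).trans hdeg, (Nat.cast_le.2 hCi).trans hdeg, fun x hx => ?_⟩
  have htel : ω * (d / 2) + ω * ∑ l ∈ range (J + 1), MvPolynomial.eval x (B l) = ω * MvPolynomial.eval x (A J) := by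
    rw [hsumB]; ring
  have happ' := happ x hx
  rw [htel] at happ'
  exact happ'.trans (by nlinarith [hηsum, Real.exp_pos (-(h : ℝ))])

/-! ## §2 Real faces of a pair [bookkeeping] -/

/-- If `‖cr + ci·i − e^{iφ}‖ ≤ ε` then `|cos φ − cr| ≤ ε`. [bookkeeping] -/
theorem abs_cos_sub_le_of_pair {cr ci φ ε : ℝ}
    (h : ‖((cr : ℝ) : ℂ) + ((ci : ℝ) : ℂ) * I - exp (((φ : ℝ) : ℂ) * I)‖ ≤ ε) : |Real.cos φ - cr| ≤ ε := by
  have hre : (((cr : ℝ) : ℂ) + ((ci : ℝ) : ℂ) * I - exp (((φ : ℝ) : ℂ) * I)).re = cr - Real.cos φ := by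
    simp only [Complex.sub_re, Complex.add_re, Complex.mul_re, Complex.ofReal_re, Complex.ofReal_im, Complex.I_re,
      Complex.I_im, Complex.exp_ofReal_mul_I_re]
    ring
  rw [abs_sub_comm, ← hre]
  exact (Complex.abs_re_le_norm _).trans h

/-- If `‖cr + ci·i − e^{iφ}‖ ≤ ε` then `|sin φ − ci| ≤ ε`. [bookkeeping] -/
theorem abs_sin_sub_le_of_pair {cr ci φ ε : ℝ}
    (h : ‖((cr : ℝ) : ℂ) + ((ci : ℝ) : ℂ) * I - exp (((φ : ℝ) : ℂ) * I)‖ ≤ ε) : |Real.sin φ - ci| ≤ ε := by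
  have him : (((cr : ℝ) : ℂ) + ((ci : ℝ) : ℂ) * I - exp (((φ : ℝ) : ℂ) * I)).im = ci - Real.sin φ := by
    simp only [Complex.sub_im, Complex.add_im, Complex.mul_im, Complex.ofReal_re, Complex.ofReal_im, Complex.I_re,
      Complex.I_im, Complex.exp_ofReal_mul_I_im]
    ring
  rw [abs_sub_comm, ← him]
  exact (Complex.abs_im_le_norm _).trans h

/-! ## §3 ★★★ The smoothed-link first-order law — parametric form [folklore] -/

/-- ★★★ **THE SMOOTHED-LINK FIRST-ORDER LAW — PARAMETRIC FORM.**  Let `σ` be a finite index set, `g(s) = c + Σ_{p∈σ}(α_p cos(ω_p s) + β_p sin(ω_p s))`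
a trigonometric link with frequencies `0 ≤ ω_p ≤ Ω`, derivative `g₁(s) = Σ_p ω_p(β_p cos(ω_p s) − α_p sin(ω_p s))`, mass `Σ_p(|α_p| + |β_p|) ≤ W`,
and assume the `C^{1,1}` data `|g(u) − g(a) − g₁(a)(u − a)| ≤ B₂(u − a)²`, `|g₁(a)| ≤ B₁` for all real `u, a`.  Then for `J : ℕ`, `h ≥ 1`, `N ≥ 2^J`
with `(J+1)e^{−h} ≤ ½` there is `P : MvPolynomial ι ℝ` of total degree `≤ 2e²·Ωd·(½ + π + 3πJ) + 2h(2^{J+1} − 1) + 2N` (`d = |ι|`) with, on `[−1,1]^ι`,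
`|g(Σ_i|x_i|) − P(x)| ≤ B₂(dπ∕2^J)² + B₁·dπ∕N + 2(J+1)e^{−h}·W·(1 + Ω(dπ∕2^J + dπ∕N))`.
PROOF: `P = c + Σ_p(α_pCr_p + β_pCi_p) + [Σ_p ω_p(β_pCr_p − α_pCi_p)]·(A_N − A_J)` with §1's pairs `(Cr_p, Ci_p) ≈ e^{iω_pA_J}` (ONE `A_J`) and the
additive Jackson approximant `A_N`; at `x`, with `s = S(x)`, `a = A_J(x)`:
`g(s) − P(x) = [g(s) − g(a) − g₁(a)(s − a)] + g₁(a)(s − A_N(x)) + [g(a) − G₀(x)] + [g₁(a) − G₁(x)](A_N(x) − a)`.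
READING (PART 3): with PART 2's Fejér–Steklov smoothing of a `K`-Lipschitz `h` (`B₁ ≍ K`, `B₂ ≍ KL∕d`, `Ω = Lπ∕d`, `W ≲ L²Kd`, `|g − h| ≲ Kd log L∕L`)
and `4^J ≍ Lt`, `N ≍ t`, `h ≍ 3log t`: `dist_∞(h∘S_d, Π_t) ≲ Kd·log³t∕t`. [folklore] -/
theorem exists_mvPolynomial_near_trigLink_firstOrder {σ : Type*} (P₀ : Finset σ) (c : ℝ) (α β ω : σ → ℝ)
    {g g₁ : ℝ → ℝ} {Ω W B₁ B₂ : ℝ}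
    (hg : ∀ s, g s = c + ∑ p ∈ P₀, (α p * Real.cos (ω p * s) + β p * Real.sin (ω p * s)))
    (hg₁ : ∀ s, g₁ s = ∑ p ∈ P₀, ω p * (β p * Real.cos (ω p * s) - α p * Real.sin (ω p * s)))
    (hΩ : 0 ≤ Ω) (hω0 : ∀ p, 0 ≤ ω p) (hωΩ : ∀ p ∈ P₀, ω p ≤ Ω) (hW : ∑ p ∈ P₀, (|α p| + |β p|) ≤ W)
    (hC11 : ∀ u a, |g u - g a - g₁ a * (u - a)| ≤ B₂ * (u - a) ^ 2) (hB₁ : ∀ a, |g₁ a| ≤ B₁)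
    (J h N : ℕ) (hh : 1 ≤ h) (hJh : ((J : ℝ) + 1) * Real.exp (-(h : ℝ)) ≤ 1 / 2) (hN : 2 ^ J ≤ N) :
    ∃ P : MvPolynomial ι ℝ,
      (P.totalDegree : ℝ) ≤ 2 * Real.exp 2 * Ω * Fintype.card ι * (1 / 2 + π + 3 * π * J) + 2 * h * (2 ^ (J + 1) - 1) + 2 * N ∧
      ∀ x : ι → ℝ, (∀ i, x i ∈ Set.Icc (-1 : ℝ) 1) →
        |g (∑ i, |x i|) - MvPolynomial.eval x P| ≤
          B₂ * (Fintype.card ι * π / 2 ^ J) ^ 2 + B₁ * (Fintype.card ι * π / N) +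
            2 * ((J : ℝ) + 1) * Real.exp (-(h : ℝ)) * W *
              (1 + Ω * (Fintype.card ι * π / 2 ^ J + Fintype.card ι * π / N)) := by
  classical
  set d : ℝ := (Fintype.card ι : ℝ) with hd
  have hd0 : 0 ≤ d := Nat.cast_nonneg _
  have hNpos : 0 < N := lt_of_lt_of_le (pow_pos two_pos J) hN
  have hNr : (0 : ℝ) < N := by exact_mod_cast hNpos
  have h2J : (0 : ℝ) < 2 ^ J := by positivity
  set ε : ℝ := 2 * ((J : ℝ) + 1) * Real.exp (-(h : ℝ)) with hε
  have hε0 : 0 ≤ ε := by positivity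
  -- sign facts from the hypotheses
  have hW0 : 0 ≤ W := le_trans (Finset.sum_nonneg fun p _ => by positivity) hW
  have hB₁0 : 0 ≤ B₁ := (abs_nonneg _).trans (hB₁ 0)
  have hB₂0 : 0 ≤ B₂ := by
    have h1 := hC11 1 0
    have : (0 : ℝ) ≤ B₂ * (1 - 0) ^ 2 := (abs_nonneg _).trans h1
    simpa using this
  -- the ladder (one `A_J`), its pairs, and the fine Jackson approximant `A_N`
  obtain ⟨A, hAdeg, hAerr, hlad⟩ := exists_ladder_pairs_near_cexp_additiveJackson_uniform (ι := ι) J h hh hJh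
  choose Cr Ci hCr hCi happ using fun p : σ => hlad (ω p) (hω0 p)
  obtain ⟨AN, hANdeg, hANerr⟩ := exists_additiveJackson (ι := ι) (M := N) hNpos
  -- degrees
  set X : ℝ := 2 * Real.exp 2 * Ω * d * (1 / 2 + π + 3 * π * J) + 2 * h * (2 ^ (J + 1) - 1) with hX
  set D : ℕ := ⌊X⌋₊ with hD
  have hXp : ∀ p ∈ P₀, 2 * Real.exp 2 * ω p * d * (1 / 2 + π + 3 * π * J) + 2 * h * (2 ^ (J + 1) - 1) ≤ X := by
    intro p hp
    have h1 : 2 * Real.exp 2 * ω p * d * (1 / 2 + π + 3 * π * J) ≤ 2 * Real.exp 2 * Ω * d * (1 / 2 + π + 3 * π * J) := by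
      have hωp := hωΩ p hp
      have hc : (0 : ℝ) ≤ 2 * Real.exp 2 := by positivity
      have hJ0 : (0 : ℝ) ≤ 1 / 2 + π + 3 * π * J := by positivity
      have : 2 * Real.exp 2 * ω p ≤ 2 * Real.exp 2 * Ω := mul_le_mul_of_nonneg_left hωp hc
      exact mul_le_mul_of_nonneg_right (mul_le_mul_of_nonneg_right this hd0) hJ0
    rw [hX]; linarith only [h1]
  have hdegCr : ∀ p ∈ P₀, (Cr p).totalDegree ≤ D := fun p hp => Nat.le_floor ((hCr p).trans (hXp p hp))
  have hdegCi : ∀ p ∈ P₀, (Ci p).totalDegree ≤ D := fun p hp => Nat.le_floor ((hCi p).trans (hXp p hp))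
  have hdegCmul : ∀ (r : ℝ) (Q : MvPolynomial ι ℝ), Q.totalDegree ≤ D → (MvPolynomial.C r * Q).totalDegree ≤ D := by
    intro r Q hQ
    calc (MvPolynomial.C r * Q).totalDegree ≤ (MvPolynomial.C r : MvPolynomial ι ℝ).totalDegree + Q.totalDegree :=
          MvPolynomial.totalDegree_mul _ _
      _ ≤ 0 + D := by rw [MvPolynomial.totalDegree_C]; exact add_le_add le_rfl hQ
      _ = D := zero_add _
  -- the polynomial
  set G₀ : MvPolynomial ι ℝ := MvPolynomial.C c + ∑ p ∈ P₀, (MvPolynomial.C (α p) * Cr p + MvPolynomial.C (β p) * Ci p) with hG₀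
  set G₁ : MvPolynomial ι ℝ := ∑ p ∈ P₀, MvPolynomial.C (ω p) * (MvPolynomial.C (β p) * Cr p - MvPolynomial.C (α p) * Ci p) with hG₁
  have hG₀deg : G₀.totalDegree ≤ D := by
    refine (MvPolynomial.totalDegree_add _ _).trans (max_le ?_ ?_)
    · rw [MvPolynomial.totalDegree_C]; exact Nat.zero_le _
    · refine MvPolynomial.totalDegree_finsetSum_le fun p hp => ?_
      exact (MvPolynomial.totalDegree_add _ _).trans (max_le (hdegCmul _ _ (hdegCr p hp)) (hdegCmul _ _ (hdegCi p hp)))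
  have hG₁deg : G₁.totalDegree ≤ D := by
    refine MvPolynomial.totalDegree_finsetSum_le fun p hp => hdegCmul _ _ ?_
    exact (MvPolynomial.totalDegree_sub _ _).trans (max_le (hdegCmul _ _ (hdegCr p hp)) (hdegCmul _ _ (hdegCi p hp)))
  have hΔdeg : (AN - A).totalDegree ≤ 2 * N := by
    refine (MvPolynomial.totalDegree_sub _ _).trans (max_le hANdeg (hAdeg.trans ?_))
    exact Nat.mul_le_mul_left 2 hN
  have hX0 : 0 ≤ X := by
    rw [hX]
    have : (1 : ℝ) ≤ 2 ^ (J + 1) := one_le_pow₀ (by norm_num)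
    have hh0 : (0 : ℝ) ≤ h := Nat.cast_nonneg _
    have h2 : (0 : ℝ) ≤ 2 * h * (2 ^ (J + 1) - 1) := by nlinarith
    positivity
  refine ⟨G₀ + G₁ * (AN - A), ?_, fun x hx => ?_⟩
  · have hnat : (G₀ + G₁ * (AN - A)).totalDegree ≤ D + 2 * N := by
      refine (MvPolynomial.totalDegree_add _ _).trans (max_le (hG₀deg.trans (Nat.le_add_right _ _)) ?_)
      exact (MvPolynomial.totalDegree_mul _ _).trans (add_le_add hG₁deg hΔdeg)
    have h1 : ((D + 2 * N : ℕ) : ℝ) ≤ X + 2 * N := by push_cast; linarith only [Nat.floor_le hX0]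
    exact ((Nat.cast_le.2 hnat).trans h1).trans (by rw [hX])
  -- the error at `x`
  set s : ℝ := ∑ i, |x i| with hs
  set a : ℝ := MvPolynomial.eval x A with ha
  set aN : ℝ := MvPolynomial.eval x AN with haN
  have hsa : |s - a| ≤ d * π / 2 ^ J := hAerr x hx
  have hsaN : |s - aN| ≤ d * π / N := (hANerr x hx).trans_eq (by rw [hd]; ring)
  have haNa : |aN - a| ≤ d * π / 2 ^ J + d * π / N := by
    calc |aN - a| = |(s - a) - (s - aN)| := by ring_nf
      _ ≤ |s - a| + |s - aN| := abs_sub _ _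
      _ ≤ d * π / 2 ^ J + d * π / N := add_le_add hsa hsaN
  -- evaluations of `G₀`, `G₁`
  have hevG₀ : MvPolynomial.eval x G₀ = c + ∑ p ∈ P₀, (α p * MvPolynomial.eval x (Cr p) + β p * MvPolynomial.eval x (Ci p)) := by
    rw [hG₀, map_add, MvPolynomial.eval_C, map_sum]
    refine congrArg _ (Finset.sum_congr rfl fun p _ => ?_)
    rw [map_add, map_mul, map_mul, MvPolynomial.eval_C, MvPolynomial.eval_C]
  have hevG₁ : MvPolynomial.eval x G₁ =
      ∑ p ∈ P₀, ω p * (β p * MvPolynomial.eval x (Cr p) - α p * MvPolynomial.eval x (Ci p)) := by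
    rw [hG₁, map_sum]
    refine Finset.sum_congr rfl fun p _ => ?_
    rw [map_mul, MvPolynomial.eval_C, map_sub, map_mul, map_mul, MvPolynomial.eval_C, MvPolynomial.eval_C]
  -- the ladder errors at `a`
  have hcos : ∀ p, |Real.cos (ω p * a) - MvPolynomial.eval x (Cr p)| ≤ ε := fun p =>
    abs_cos_sub_le_of_pair (happ p x hx)
  have hsin : ∀ p, |Real.sin (ω p * a) - MvPolynomial.eval x (Ci p)| ≤ ε := fun p =>
    abs_sin_sub_le_of_pair (happ p x hx)
  have hE₀ : |g a - MvPolynomial.eval x G₀| ≤ ε * W := by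
    rw [hg a, hevG₀, add_sub_add_left_eq_sub, ← Finset.sum_sub_distrib]
    calc |∑ p ∈ P₀, (α p * Real.cos (ω p * a) + β p * Real.sin (ω p * a) -
            (α p * MvPolynomial.eval x (Cr p) + β p * MvPolynomial.eval x (Ci p)))|
        ≤ ∑ p ∈ P₀, |α p * Real.cos (ω p * a) + β p * Real.sin (ω p * a) -
            (α p * MvPolynomial.eval x (Cr p) + β p * MvPolynomial.eval x (Ci p))| := abs_sum_le_sum_abs _ _
      _ ≤ ∑ p ∈ P₀, (|α p| + |β p|) * ε := by
          refine Finset.sum_le_sum fun p _ => ?_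
          have e : α p * Real.cos (ω p * a) + β p * Real.sin (ω p * a) -
              (α p * MvPolynomial.eval x (Cr p) + β p * MvPolynomial.eval x (Ci p)) =
              α p * (Real.cos (ω p * a) - MvPolynomial.eval x (Cr p)) + β p * (Real.sin (ω p * a) - MvPolynomial.eval x (Ci p)) := by
            ring
          rw [e]
          calc |α p * (Real.cos (ω p * a) - MvPolynomial.eval x (Cr p)) + β p * (Real.sin (ω p * a) - MvPolynomial.eval x (Ci p))|
              ≤ |α p * (Real.cos (ω p * a) - MvPolynomial.eval x (Cr p))| + |β p * (Real.sin (ω p * a) - MvPolynomial.eval x (Ci p))| :=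
                abs_add_le _ _
            _ ≤ |α p| * ε + |β p| * ε := by
                rw [abs_mul, abs_mul]
                exact add_le_add (mul_le_mul_of_nonneg_left (hcos p) (abs_nonneg _))
                  (mul_le_mul_of_nonneg_left (hsin p) (abs_nonneg _))
            _ = (|α p| + |β p|) * ε := by ring
      _ = (∑ p ∈ P₀, (|α p| + |β p|)) * ε := by rw [Finset.sum_mul]
      _ ≤ W * ε := mul_le_mul_of_nonneg_right hW hε0
      _ = ε * W := mul_comm _ _
  have hE₁ : |g₁ a - MvPolynomial.eval x G₁| ≤ ε * W * Ω := by
    rw [hg₁ a, hevG₁, ← Finset.sum_sub_distrib]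
    calc |∑ p ∈ P₀, (ω p * (β p * Real.cos (ω p * a) - α p * Real.sin (ω p * a)) -
            ω p * (β p * MvPolynomial.eval x (Cr p) - α p * MvPolynomial.eval x (Ci p)))|
        ≤ ∑ p ∈ P₀, |ω p * (β p * Real.cos (ω p * a) - α p * Real.sin (ω p * a)) -
            ω p * (β p * MvPolynomial.eval x (Cr p) - α p * MvPolynomial.eval x (Ci p))| := abs_sum_le_sum_abs _ _
      _ ≤ ∑ p ∈ P₀, (|α p| + |β p|) * ε * Ω := by
          refine Finset.sum_le_sum fun p hp => ?_
          have e : ω p * (β p * Real.cos (ω p * a) - α p * Real.sin (ω p * a)) -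
              ω p * (β p * MvPolynomial.eval x (Cr p) - α p * MvPolynomial.eval x (Ci p)) =
              ω p * (β p * (Real.cos (ω p * a) - MvPolynomial.eval x (Cr p)) - α p * (Real.sin (ω p * a) - MvPolynomial.eval x (Ci p))) := by
            ring
          rw [e, abs_mul, abs_of_nonneg (hω0 p)]
          have h1 : |β p * (Real.cos (ω p * a) - MvPolynomial.eval x (Cr p)) - α p * (Real.sin (ω p * a) - MvPolynomial.eval x (Ci p))| ≤
              (|α p| + |β p|) * ε := by
            calc |β p * (Real.cos (ω p * a) - MvPolynomial.eval x (Cr p)) - α p * (Real.sin (ω p * a) - MvPolynomial.eval x (Ci p))|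
                ≤ |β p * (Real.cos (ω p * a) - MvPolynomial.eval x (Cr p))| + |α p * (Real.sin (ω p * a) - MvPolynomial.eval x (Ci p))| :=
                  abs_sub _ _
              _ ≤ |β p| * ε + |α p| * ε := by
                  rw [abs_mul, abs_mul]
                  exact add_le_add (mul_le_mul_of_nonneg_left (hcos p) (abs_nonneg _))
                    (mul_le_mul_of_nonneg_left (hsin p) (abs_nonneg _))
              _ = (|α p| + |β p|) * ε := by ring
          calc ω p * |β p * (Real.cos (ω p * a) - MvPolynomial.eval x (Cr p)) - α p * (Real.sin (ω p * a) - MvPolynomial.eval x (Ci p))|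
              ≤ Ω * ((|α p| + |β p|) * ε) := mul_le_mul (hωΩ p hp) h1 (abs_nonneg _) hΩ
            _ = (|α p| + |β p|) * ε * Ω := by ring
      _ = (∑ p ∈ P₀, (|α p| + |β p|)) * ε * Ω := by rw [Finset.sum_mul, Finset.sum_mul]
      _ ≤ W * ε * Ω := mul_le_mul_of_nonneg_right (mul_le_mul_of_nonneg_right hW hε0) hΩ
      _ = ε * W * Ω := by ring
  -- assemble
  have hev : MvPolynomial.eval x (G₀ + G₁ * (AN - A)) = MvPolynomial.eval x G₀ + MvPolynomial.eval x G₁ * (aN - a) := by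
    rw [map_add, map_mul, map_sub]
  rw [hev]
  have hsplit : g s - (MvPolynomial.eval x G₀ + MvPolynomial.eval x G₁ * (aN - a)) =
      (g s - g a - g₁ a * (s - a)) + g₁ a * (s - aN) + (g a - MvPolynomial.eval x G₀) +
        (g₁ a - MvPolynomial.eval x G₁) * (aN - a) := by ring
  rw [hsplit]
  have hT1 : |g s - g a - g₁ a * (s - a)| ≤ B₂ * (d * π / 2 ^ J) ^ 2 := by
    refine (hC11 s a).trans (mul_le_mul_of_nonneg_left ?_ hB₂0)
    rw [← sq_abs]
    exact pow_le_pow_left₀ (abs_nonneg _) hsa 2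
  have hT2 : |g₁ a * (s - aN)| ≤ B₁ * (d * π / N) := by
    rw [abs_mul]; exact mul_le_mul (hB₁ a) hsaN (abs_nonneg _) hB₁0
  have hT4 : |(g₁ a - MvPolynomial.eval x G₁) * (aN - a)| ≤ ε * W * Ω * (d * π / 2 ^ J + d * π / N) := by
    rw [abs_mul]
    exact mul_le_mul hE₁ haNa (abs_nonneg _) ((abs_nonneg _).trans hE₁)
  calc |(g s - g a - g₁ a * (s - a)) + g₁ a * (s - aN) + (g a - MvPolynomial.eval x G₀) +
        (g₁ a - MvPolynomial.eval x G₁) * (aN - a)|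
      ≤ |g s - g a - g₁ a * (s - a)| + |g₁ a * (s - aN)| + |g a - MvPolynomial.eval x G₀| +
        |(g₁ a - MvPolynomial.eval x G₁) * (aN - a)| := by
        refine (abs_add_le _ _).trans (add_le_add ((abs_add_le _ _).trans (add_le_add (abs_add_le _ _) le_rfl)) le_rfl)
    _ ≤ B₂ * (d * π / 2 ^ J) ^ 2 + B₁ * (d * π / N) + ε * W + ε * W * Ω * (d * π / 2 ^ J + d * π / N) :=
        add_le_add (add_le_add (add_le_add hT1 hT2) hE₀) hT4
    _ = B₂ * (d * π / 2 ^ J) ^ 2 + B₁ * (d * π / N) + ε * W * (1 + Ω * (d * π / 2 ^ J + d * π / N)) := by ring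

end Summit.QuantumFields.YangMills.Theorems.BalabanUVNodesN19SmoothLinkFirstOrder

end
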